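import Literature.NumberTheory.Weil1964.ArchFollandTorusAdelic
import Literature.NumberTheory.Automorphic.UnitaryGroupAdelicProduct
import Literature.NumberTheory.GelbartRogawski1991.UnitaryDualPairSplittingDatum
import HarnessLib

/-!
# Restriction of scalars `E/F` read at a complex place: the archimedean `v`-slices of `ι_𝔸` (STEP 3(a))

Topic `NumberTheory/Weil1964`; namespace `Literature.NumberTheory.Weil1964`. Definitions and proved lemmas only:
**no named facts, no records, 0 proof holes**.

**Setting.** `E/F` a quadratic extension of number fields with involution `c`, `δ ∈ E` with `c δ = −δ ≠ 0`,
`δ² = d ∈ F`; the adelic quadratic coordinates `Ψ_𝔸 : 𝔸_F × 𝔸_F ≃ 𝔸_E`, `(a, b) ↦ a ⊗ 1 + (b ⊗ 1) δ`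
(`quadraticAdeleEquiv`, `isQuadraticCoordinates_adele`) and the restriction-of-scalars action
`Res G = resEnd Ψ_𝔸 G` of `G ∈ Mₙ(𝔸_E)` on `𝔸_Fⁿ × 𝔸_Fⁿ` (`UnitaryGroupSymplecticEmbedding`); on the other side a REAL
place `v` of `F`, a COMPLEX place `w` of `E` over it (`hover : w.comap (F → E) = v`) with `σ_w(δ)` purely imaginary,
and the complex coordinates `complexCoords (σ_w δ) : ℝ × ℝ ≃ ℂ`, `(x, y) ↦ x + y σ_w(δ)`
(`isQuadraticCoordinates_complex`).  The archimedean coordinates of the Weil1964 files: `archVec`, `piArch`, `archAct`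
(`ArchSchrodingerFollandDictionary`) and the `v`-slice `placeVec v a = ((a_j)_v)_j` (`ArchFollandTorusAdelic`).

* §1 `σ_w ∘ ι_w = σ_v` on `F_v` (`extensionEmbedding_toInfPlace`, automatic over a real `v`:
  `extensionEmbedding_toInfPlace_of_isReal`), `ι_w : F_v → E_w` the local base change `toInfPlace`.
* §2 `adeleAt w : 𝔸_E →+* ℂ`, `x ↦ σ_w(x_w)`; `adeleMatAt w G = (σ_w((G i j)_w))` (for `u ∈ U(J)(𝔸_F)` the matrix of
  `archAt w (archPart u)`, by `rfl`); `extensionEmbedding_quadraticInfLocalEquiv`: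
  `σ_w (Ψ_v (p, q))_w = complexCoords (σ_w δ) (σ_v p, σ_v q)`; `extensionEmbeddingOfIsReal_quadraticAdeleEquiv_symm`:
  the `v`-coordinates of `Ψ_𝔸⁻¹ Y`, read in `ℝ`, are `complexCoords⁻¹ (σ_w Y_w)` (NO uniqueness of `w ∣ v` is used:
  the proof evaluates `Ψ_v ∘ Ψ_v⁻¹ = id` at `w`); and the **CORE** `placeVec_piArch_resEnd`:
  `((piArch (Res G (archVec a, archVec b)).1)_v, (piArch (…).2)_v) = Res_{ℂ/ℝ} (G_w) (a_v, b_v)` — restriction of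
  scalars on `𝔸_E`-matrices commutes with passing to the complex place `w ∣ v`; any fintype index, no unitarity.
* §3 `IsQuadraticCoordinates.resEnd_reindex_apply`: `Res (reindex e e G) = e ∘ Res G ∘ e⁻¹` (matrix version of the
  tree's `resAut_reindexGL`).
* §4 through the unitary carrier maps: **`placeVec_archAct_adelicToSymplectic`** — for `u ∈ U(J)(𝔸_F)` the
  `v`-slices of `archAct (adelicToSymplectic u)` are `archLocalToSymplectic w (archAt w (archPart u))` on
  `(a_v, b_v)`: verbatim the hypothesis `hg` of `archFolland_archAct_archLocalTorus` (STEP 2) with the actual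
  `w`-component in place of a torus element; **`placeVec_archAct_toSp`** — the same for the dual-pair decl of record
  `GelbartRogawski1991.UnitaryDualPair.toSp = spReindex e ∘ adelicPairToSymplectic` on `G₁(𝔸_F) = U(J_V ⊗ J_W)(𝔸_F)`
  (Gram matrix `adelicGram e T_V T_W`, index `Fin m ≃ Fin N × Fin M`): the `v`-slices are `Res_{ℂ/ℝ}` of
  `reindex e e (u_w)`; its pair-factored form **`placeVec_archAct_toSp_inl_mul_inr`** on `u = a(u₁) · b(u₂)`
  (`adeleMatAt_adelicInl_mul_adelicInr`: `u_w = (u₁)_w ⊗ₖ (u₂)_w`, no torus hypothesis); and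
  **`archAct_toSp_torus`** — when every `u_{w(v)}` is the relabelled compact torus
  `reindex e⁻¹ e⁻¹ (torusGL θ_{·,v})`, the literal `hg` of `archFolland_archAct_torus` (STEP 2, `ι = Fin m`,
  `Ψ v = complexCoords (σ_{w(v)} δ)`): `(archAct 𝕋 (toSp u) (a, b))_v = resAut (torusGL θ_{·,v}) (a_v, b_v)`.

Dictionary with print: the embedding `ι : G(𝐀) → Sp_𝐀(𝕎)` of the unitary group of a hermitian space over `E` into
the symplectic group of the underlying `F`-space `𝕎 = Res_{E/F} V` [GelbartRogawski1991, §3.1 p. 454;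
Mœglin–Vignéras–Waldspurger Ch. 1 I.17] is restriction of scalars, and `E ⊗_F 𝔸_F = 𝔸_E` with
`E ⊗_F F_v = ∏_{w ∣ v} E_w` [CasselsFrohlichANT1967, Ch. II §14]; so the archimedean component of `ι(u)` at a real
place `v` of `F` lying under a complex place `w` of `E` is `Res_{ℂ/ℝ}` of `u_w ∈ GLₙ(E_w) = GLₙ(ℂ)` in the basis
`(1, σ_w δ)` — the present file is that bookkeeping, kernel-checked against the tree's `Ψ_𝔸`, `Ψ_∞`, `Ψ_v`,
`toInfPlace` and Mathlib's `extensionEmbedding`; no analysis.  With STEP 2 (`ArchFollandTorusAdelic`) and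
`ArchFollandCocycleOne` it identifies the archimedean factor of a `ρ_𝕋(ι u)`-implementer, for `u` with toral
archimedean components, as exactly `rhoSD`-covariant over `realify (diagHom (torusPt (ε · θ)))`.

## Mathlib / tree

Mathlib: `NumberField.InfinitePlace.Completion.extensionEmbedding` (`extensionEmbedding_coe`,
`isometry_extensionEmbedding`), `Completion.extensionEmbeddingOfIsReal` (`extensionEmbeddingOfIsReal_apply`),
`Completion.induction_on`, `InfinitePlace.comap_mk`, `mk_embedding`, `isReal_mk_iff`, `embedding_mk_eq_of_isReal`,
`InfiniteAdeleRing.ringEquiv_mixedSpace` (`_apply`), `AdeleRing.algebraMap_fst_apply`, `RingHom.map_mulVec`,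
`Matrix.submatrix_mulVec_equiv`.
Tree: `UnitaryGroup.InfPlacesOver`, `toInfPlace` (`toInfPlace_coe`, `continuous_toInfPlace`),
`infiniteAdele_baseChange_apply_placesOver`, `quadraticInfLocalEquiv` (`quadraticInfLocalMap_apply_apply`),
`quadraticInfiniteAdeleEquiv_symm_apply_local`, `quadraticAdeleEquiv` (`_apply`, `_symm_fst`),
`not_mem_range_algebraMap_of_apply_eq_neg`, `AdeleRing.baseChange_fst`, `isQuadraticCoordinates_adele`,
`isQuadraticCoordinates_complex`, `complexCoords` (`_apply`), `IsQuadraticCoordinates.resEnd` (`resEnd_reIm`,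
`resAut_apply`), `QuadraticCoordinates.reIm`, `reindexW`, `adelicToSymplectic`, `archLocalToSymplectic`, `archAt`
(`coe_archAt_apply`), `archPart`, `re_embedding_delta`, `im_embedding_delta_ne_zero`, `adelicPair`,
`GelbartRogawski1991.UnitaryDualPair.toSp`, `adelicGram`, `torusGL`, `archVec`, `piArch`, `archAct`, `placeVec`.

## References
* [GelbartRogawski1991] S. Gelbart, J. Rogawski, *L-functions and Fourier–Jacobi coefficients for the unitary group
  U(3)*, Invent. Math. 105 (1991), §3.1 p. 454.
* [CasselsFrohlichANT1967] J. W. S. Cassels, A. Fröhlich (eds.), *Algebraic Number Theory*, Academic Press (1967),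
  Ch. II §14.
* [Folland1989] G. B. Folland, *Harmonic Analysis in Phase Space*, Princeton UP (1989), Ch. 4 §1, Prop. (4.6).
-/
open scoped Matrix Kronecker
open NumberField NumberField.InfinitePlace NumberField.mixedEmbedding IsDedekindDomain

namespace Literature.NumberTheory.Weil1964

open Literature.NumberTheory.Automorphic Literature.NumberTheory.Automorphic.UnitaryGroup QuadraticCoordinates

/-! ## §1 `σ_w ∘ ι_w = σ_v` on `F_v` -/

section Compat

variable (F : Type) [Field F] (E : Type) [Field E] [Algebra F E]

/-- **`σ_w ∘ ι_w = σ_v` on `F_v`** when `σ_w ∘ (F → E) = σ_v` (`ι_w : F_v → E_w` the local base change at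
`w ∣ v`). [folklore] -/
theorem extensionEmbedding_toInfPlace (v : InfinitePlace F) (w : InfPlacesOver E v)
    (hemb : w.1.embedding.comp (algebraMap F E) = v.embedding) (x : v.Completion) :
    Completion.extensionEmbedding w.1 (toInfPlace E v w x) = Completion.extensionEmbedding v x := by
  induction x using Completion.induction_on with
  | hp =>
    exact isClosed_eq ((Completion.isometry_extensionEmbedding w.1).continuous.comp (continuous_toInfPlace E v w))
      (Completion.isometry_extensionEmbedding v).continuous
  | ih a =>
    have h1 := toInfPlace_coe E v w (WithAbs.equiv v.1 a)
    have h4 : w.1.embedding (algebraMap F E (WithAbs.equiv v.1 a)) = v.embedding (WithAbs.equiv v.1 a) := by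
      rw [← hemb]; rfl
    simp only [WithAbs.equiv_apply] at h1 h4
    simp [h1, h4, Completion.extensionEmbedding_coe]

/-- Over a real place `v` of `F` every place `w ∣ v` of `E` satisfies `σ_w ∘ (F → E) = σ_v`. [folklore] -/
theorem embedding_comp_eq_of_isReal (v : InfinitePlace F) (hv : v.IsReal) (w : InfPlacesOver E v) :
    w.1.embedding.comp (algebraMap F E) = v.embedding := by
  obtain ⟨w, rfl⟩ := w
  have hmk : InfinitePlace.mk (w.embedding.comp (algebraMap F E)) = w.comap (algebraMap F E) := by
    rw [← InfinitePlace.comap_mk, InfinitePlace.mk_embedding]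
  have hre : ComplexEmbedding.IsReal (w.embedding.comp (algebraMap F E)) := by
    rw [← InfinitePlace.isReal_mk_iff, hmk]; exact hv
  rw [← InfinitePlace.embedding_mk_eq_of_isReal hre, hmk]

/-- **`σ_w (ι_w x) = σ_v (x)`** for `v` real, `w ∣ v`, `x ∈ F_v` (as a real number coerced to `ℂ`). [folklore] -/
theorem extensionEmbedding_toInfPlace_of_isReal (v : InfinitePlace F) (hv : v.IsReal) (w : InfPlacesOver E v)
    (x : v.Completion) :
    Completion.extensionEmbedding w.1 (toInfPlace E v w x) =
      ((Completion.extensionEmbeddingOfIsReal hv x : ℝ) : ℂ) := by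
  rw [extensionEmbedding_toInfPlace F E v w (embedding_comp_eq_of_isReal F E v hv w),
    Completion.extensionEmbeddingOfIsReal_apply]

end Compat

/-! ## §2 Restriction of scalars on `𝔸_E`-matrices read at a complex place `w ∣ v` -/

section Core

variable (F : Type) [Field F] [NumberField F] (E : Type) [Field E] [NumberField E] [Algebra F E]
  (c : E ≃ₐ[F] E) (n : Type) [Fintype n] [DecidableEq n]

/-- **`x ↦ σ_w(x_w) : 𝔸_E →+* ℂ`**, an adele of `E` read at the complex place `w`. [folklore] -/
noncomputable def adeleAt (w : {w : InfinitePlace E // w.IsComplex}) : AdeleRing (𝓞 E) E →+* ℂ :=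
  (Completion.extensionEmbedding w.1).comp
    ((Pi.evalRingHom (fun w : InfinitePlace E => w.Completion) w.1).comp
      (RingHom.fst (InfiniteAdeleRing E) (FiniteAdeleRing (𝓞 E) E)))

omit [NumberField F] [Algebra F E] in
/-- formula. [folklore] -/
@[simp] theorem adeleAt_apply (w : {w : InfinitePlace E // w.IsComplex}) (x : AdeleRing (𝓞 E) E) :
    adeleAt E w x = Completion.extensionEmbedding w.1 (x.1 w.1) := rfl

/-- **`G_w = (σ_w((G i j)_w))_{i j}`**: an adelic matrix over `E` read at the complex place `w`; for
`u ∈ U(J)(𝔸_F)` this is the matrix of `archAt w (archPart u)` (`coe_archAt_apply`). [folklore] -/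
noncomputable def adeleMatAt (w : {w : InfinitePlace E // w.IsComplex}) (G : Matrix n n (AdeleRing (𝓞 E) E)) :
    Matrix n n ℂ :=
  G.map (adeleAt E w)

omit [NumberField F] [Algebra F E] [Fintype n] [DecidableEq n] in
/-- entries of `adeleMatAt`. [folklore] -/
@[simp] theorem adeleMatAt_apply (w : {w : InfinitePlace E // w.IsComplex}) (G : Matrix n n (AdeleRing (𝓞 E) E))
    (i j : n) : adeleMatAt E n w G i j = Completion.extensionEmbedding w.1 ((G i j).1 w.1) := rfl

variable [Algebra.IsQuadraticExtension F E]

/-- **`σ_w ∘ Ψ_v = complexCoords (σ_w δ) ∘ (σ_v × σ_v)`**: the local quadratic coordinates `Ψ_v (p, q) = ι_w p +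
ι_w q · δ` at `w ∣ v` (`v` real, `w` complex), read through `σ_w : E_w → ℂ`, are the complex coordinates
`(x, y) ↦ x + y σ_w(δ)` of `σ_v p, σ_v q`. [folklore] -/
theorem extensionEmbedding_quadraticInfLocalEquiv {δ : E} (hδF : δ ∉ Set.range (algebraMap F E))
    (v : {v : InfinitePlace F // v.IsReal}) (w : {w : InfinitePlace E // w.IsComplex})
    (hover : w.1.comap (algebraMap F E) = v.1) (hre : (w.1.embedding δ).re = 0) (him : (w.1.embedding δ).im ≠ 0)
    (p : v.1.Completion × v.1.Completion) :
    Completion.extensionEmbedding w.1 (quadraticInfLocalEquiv E v.1 hδF p ⟨w.1, hover⟩) =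
      complexCoords (w.1.embedding δ) hre him
        (Completion.extensionEmbeddingOfIsReal v.2 p.1, Completion.extensionEmbeddingOfIsReal v.2 p.2) := by
  change Completion.extensionEmbedding w.1 (quadraticInfLocalMap E v.1 δ p ⟨w.1, hover⟩) = _
  rw [quadraticInfLocalMap_apply_apply, map_add, map_mul,
    extensionEmbedding_toInfPlace_of_isReal F E v.1 v.2 ⟨w.1, hover⟩,
    extensionEmbedding_toInfPlace_of_isReal F E v.1 v.2 ⟨w.1, hover⟩, Completion.extensionEmbedding_coe,
    complexCoords_apply]
  simp

/-- **The `v`-coordinates of `Ψ_𝔸⁻¹ Y`, read in `ℝ`, are `complexCoords⁻¹ (σ_w (Y_w))`.** [folklore] -/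
theorem extensionEmbeddingOfIsReal_quadraticAdeleEquiv_symm {δ : E} (hcδ : c δ = -δ) (hδ : δ ≠ 0)
    (v : {v : InfinitePlace F // v.IsReal}) (w : {w : InfinitePlace E // w.IsComplex})
    (hover : w.1.comap (algebraMap F E) = v.1) (hre : (w.1.embedding δ).re = 0) (him : (w.1.embedding δ).im ≠ 0)
    (Y : AdeleRing (𝓞 E) E) :
    (Completion.extensionEmbeddingOfIsReal v.2 (((quadraticAdeleEquiv F E c hcδ hδ).symm Y).1.1 v.1),
      Completion.extensionEmbeddingOfIsReal v.2 (((quadraticAdeleEquiv F E c hcδ hδ).symm Y).2.1 v.1)) =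
      (complexCoords (w.1.embedding δ) hre him).symm (adeleAt E w Y) := by
  have hδF : δ ∉ Set.range (algebraMap F E) := not_mem_range_algebraMap_of_apply_eq_neg E c hcδ hδ
  rw [AddEquiv.eq_symm_apply]
  set p : v.1.Completion × v.1.Completion := (quadraticInfLocalEquiv E v.1 hδF).symm fun w' => Y.1 w'.1 with hp_def
  have hp : ((((quadraticAdeleEquiv F E c hcδ hδ).symm Y).1.1 v.1),
      (((quadraticAdeleEquiv F E c hcδ hδ).symm Y).2.1 v.1)) = p := by
    rw [hp_def, ← quadraticInfiniteAdeleEquiv_symm_apply_local E hδF Y.1 v.1]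
    have h3 := congrArg (fun q : InfiniteAdeleRing F × InfiniteAdeleRing F => (q.1 v.1, q.2 v.1))
      (quadraticAdeleEquiv_symm_fst E c hcδ hδ Y)
    exact h3
  have h4 : (Completion.extensionEmbeddingOfIsReal v.2 (((quadraticAdeleEquiv F E c hcδ hδ).symm Y).1.1 v.1),
      Completion.extensionEmbeddingOfIsReal v.2 (((quadraticAdeleEquiv F E c hcδ hδ).symm Y).2.1 v.1)) =
      (Completion.extensionEmbeddingOfIsReal v.2 p.1, Completion.extensionEmbeddingOfIsReal v.2 p.2) := by
    rw [← hp]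
  rw [h4, ← extensionEmbedding_quadraticInfLocalEquiv F E hδF v w hover hre him p, hp_def,
    ContinuousLinearEquiv.apply_symm_apply, adeleAt_apply]

omit [Fintype n] [DecidableEq n] in
/-- **`σ_w` of `Ψ_𝔸 (archVec a, archVec b)_i` is `complexCoords (a_{i,v}, b_{i,v})`.** [folklore] -/
theorem adeleAt_quadraticAdeleEquiv_archVec {δ : E} (hcδ : c δ = -δ) (hδ : δ ≠ 0)
    (v : {v : InfinitePlace F // v.IsReal}) (w : {w : InfinitePlace E // w.IsComplex})
    (hover : w.1.comap (algebraMap F E) = v.1) (hre : (w.1.embedding δ).re = 0) (him : (w.1.embedding δ).im ≠ 0)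
    (a b : n → mixedSpace F) (i : n) :
    adeleAt E w (quadraticAdeleEquiv F E c hcδ hδ (archVec F n a i, archVec F n b i)) =
      complexCoords (w.1.embedding δ) hre him (placeVec F n v a i, placeVec F n v b i) := by
  have hbc : ∀ x : n → mixedSpace F, Completion.extensionEmbedding w.1
      ((AdeleRing.baseChange F E (archVec F n x i)).1 w.1) = ((placeVec F n v x i : ℝ) : ℂ) := by
    intro x
    rw [AdeleRing.baseChange_fst, infiniteAdele_baseChange_apply_placesOver E v.1 (archVec F n x i).1 ⟨w.1, hover⟩,
      extensionEmbedding_toInfPlace_of_isReal F E v.1 v.2 ⟨w.1, hover⟩]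
    have e1 := congrArg (fun y : mixedSpace F => y.1 v)
      ((InfiniteAdeleRing.ringEquiv_mixedSpace F).apply_symm_apply (x i))
    exact congrArg _ e1
  have hδw : adeleAt E w (algebraMap E (AdeleRing (𝓞 E) E) δ) = w.1.embedding δ := by
    rw [adeleAt_apply, AdeleRing.algebraMap_fst_apply, Completion.extensionEmbedding_coe]
    simp
  rw [quadraticAdeleEquiv_apply, map_add, map_mul, adeleAt_apply, adeleAt_apply, hbc, hbc, hδw, complexCoords_apply]

/-- **CORE — restriction of scalars `E/F` on `𝔸_E`-matrices commutes with passing to the complex place `w ∣ v`.**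
For `G ∈ Mₙ(𝔸_E)`, `v` a real place of `F` and `w` a complex place of `E` over `v` (`σ_w δ` purely imaginary), the
`v`-slices of the archimedean coordinates of `Res_{𝔸_E/𝔸_F} G` acting on an archimedean pair `(a, b)` are
`Res_{ℂ/ℝ}(G_w)` acting on the `v`-slices `(a_v, b_v)`: `(piArch (Res G (a, b)))_v = Res (G_w) (a_v, b_v)`. Any
fintype index `n`; no unitarity; no uniqueness of `w` needed (the proof evaluates `Ψ_v ∘ Ψ_v⁻¹ = id` at `w`).
[folklore] -/
theorem placeVec_piArch_resEnd {δ : E} (hcδ : c δ = -δ) (hδ : δ ≠ 0) {d : F} (hd : δ * δ = algebraMap F E d)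
    (v : {v : InfinitePlace F // v.IsReal}) (w : {w : InfinitePlace E // w.IsComplex})
    (hover : w.1.comap (algebraMap F E) = v.1) (hre : (w.1.embedding δ).re = 0) (him : (w.1.embedding δ).im ≠ 0)
    (G : Matrix n n (AdeleRing (𝓞 E) E)) (a b : n → mixedSpace F) :
    (placeVec F n v (piArch F n ((isQuadraticCoordinates_adele E c hcδ hδ hd).resEnd n G
        (archVec F n a, archVec F n b)).1),
      placeVec F n v (piArch F n ((isQuadraticCoordinates_adele E c hcδ hδ hd).resEnd n G
        (archVec F n a, archVec F n b)).2)) =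
      (isQuadraticCoordinates_complex (w.1.embedding δ) hre him).resEnd n (adeleMatAt E n w G)
        (placeVec F n v a, placeVec F n v b) := by
  set Ψ : (AdeleRing (𝓞 F) F × AdeleRing (𝓞 F) F) ≃+ AdeleRing (𝓞 E) E :=
    (quadraticAdeleEquiv F E c hcδ hδ).toAddEquiv with hΨ
  set cc : (ℝ × ℝ) ≃+ ℂ := complexCoords (w.1.embedding δ) hre him with hcc
  set z : n → AdeleRing (𝓞 E) E := fun i => Ψ (archVec F n a i, archVec F n b i) with hz_def
  set zc : n → ℂ := fun i => cc (placeVec F n v a i, placeVec F n v b i) with hzc_def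
  have h1 : (isQuadraticCoordinates_adele E c hcδ hδ hd).resEnd n G (archVec F n a, archVec F n b) =
      reIm Ψ n (G *ᵥ z) := by
    rw [← (isQuadraticCoordinates_adele E c hcδ hδ hd).resEnd_reIm]
    exact congrArg _ ((reIm Ψ n).apply_symm_apply _).symm
  have h2 : (isQuadraticCoordinates_complex (w.1.embedding δ) hre him).resEnd n (adeleMatAt E n w G)
      (placeVec F n v a, placeVec F n v b) = reIm cc n (adeleMatAt E n w G *ᵥ zc) := by
    rw [← (isQuadraticCoordinates_complex (w.1.embedding δ) hre him).resEnd_reIm]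
    exact congrArg _ ((reIm cc n).apply_symm_apply _).symm
  have hz : ∀ i, adeleAt E w (z i) = zc i := fun i =>
    adeleAt_quadraticAdeleEquiv_archVec F E c n hcδ hδ v w hover hre him a b i
  have hGz : ∀ j, adeleAt E w ((G *ᵥ z) j) = (adeleMatAt E n w G *ᵥ zc) j := by
    intro j
    rw [RingHom.map_mulVec]
    congr 1
    funext i
    exact hz i
  have hloc := fun Y => extensionEmbeddingOfIsReal_quadraticAdeleEquiv_symm F E c hcδ hδ v w hover hre him Y
  rw [h1, h2]
  refine Prod.ext (funext fun j => ?_) (funext fun j => ?_)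
  · change Completion.extensionEmbeddingOfIsReal v.2 (((quadraticAdeleEquiv F E c hcδ hδ).symm ((G *ᵥ z) j)).1.1 v.1)
      = (cc.symm ((adeleMatAt E n w G *ᵥ zc) j)).1
    rw [← hGz j, ← hloc]
  · change Completion.extensionEmbeddingOfIsReal v.2 (((quadraticAdeleEquiv F E c hcδ hδ).symm ((G *ᵥ z) j)).2.1 v.1)
      = (cc.symm ((adeleMatAt E n w G *ᵥ zc) j)).2
    rw [← hGz j, ← hloc]

end Core

/-! ## §3 Relabelling the index: `Res (reindex e e G) = e ∘ Res G ∘ e⁻¹` -/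

section Reindex

variable {R S : Type*} [CommRing R] [CommRing S] {φ : R →+* S} {Ψ : (R × R) ≃+ S} {δ : S} {d : R}
variable {n n' : Type*} [Fintype n] [Fintype n'] [DecidableEq n] [DecidableEq n']

/-- **`Res (reindex e e G) = e ∘ Res G ∘ e⁻¹`** on `Rⁿ' × Rⁿ'` (matrix version of the tree's
`IsQuadraticCoordinates.resAut_reindexGL`). [folklore] -/
theorem _root_.Literature.NumberTheory.Automorphic.UnitaryGroup.IsQuadraticCoordinates.resEnd_reindex_apply
    (h : IsQuadraticCoordinates φ Ψ δ d) (e : n ≃ n') (G : Matrix n n S) (p : (n' → R) × (n' → R)) :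
    h.resEnd n' (Matrix.reindex e e G) p = reindexW R e (h.resEnd n G ((reindexW R e).symm p)) := by
  obtain ⟨x, rfl⟩ := (reIm Ψ n').surjective p
  have hx : (reindexW R e).symm (reIm Ψ n' x) = reIm Ψ n (x ∘ e) := rfl
  rw [h.resEnd_reIm, hx, h.resEnd_reIm, Matrix.reindex_apply, Matrix.submatrix_mulVec_equiv, Equiv.symm_symm]
  rfl

end Reindex

/-! ## §4 Through the unitary-group carrier maps: `adelicToSymplectic`, the decl of record `UnitaryDualPair.toSp` -/

section Unitary

variable (F : Type) [Field F] [NumberField F] (E : Type) [Field E] [NumberField E] [Algebra F E]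
  [Algebra.IsQuadraticExtension F E] (c : E ≃ₐ[F] E)

/-- **(α) `ι_𝔸 = ι_w` on archimedean `v`-slices.** For `u ∈ U(J)(𝔸_F)` (`J = T ⊗ 1`), the `v`-slices of
`archAct (ι_𝔸 u)` (`ι_𝔸 = adelicToSymplectic`) are `archLocalToSymplectic` at the complex place `w ∣ v` applied to
the `w`-component `archAt w (archPart u)` — verbatim the hypothesis `hg` of `archFolland_archAct_archLocalTorus`
(STEP 2) with `archAt w (archPart u)` for the torus element. [cite: GelbartRogawski1991, §3.1 p. 454] -/
theorem placeVec_archAct_adelicToSymplectic (N : ℕ) {δ : E} (hcδ : c δ = -δ) (hδ : δ ≠ 0) (hc : c ≠ 1) {d : F}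
    (hd : δ * δ = algebraMap F E d) {T : Matrix (Fin N) (Fin N) F} (hT : T.IsSymm) {J : Matrix (Fin N) (Fin N) E}
    (hJ : J = T.map (algebraMap F E)) (v : {v : InfinitePlace F // v.IsReal})
    (w : {w : InfinitePlace E // w.IsComplex}) (hw : c • w.1 = w.1) (hover : w.1.comap (algebraMap F E) = v.1)
    (u : adelic F E c N J) (a b : Fin N → mixedSpace F) :
    (placeVec F (Fin N) v (archAct (T.map (algebraMap F (AdeleRing (𝓞 F) F)))
        (adelicToSymplectic F E c N hcδ hδ hd hT hJ u) (a, b)).1,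
      placeVec F (Fin N) v (archAct (T.map (algebraMap F (AdeleRing (𝓞 F) F)))
        (adelicToSymplectic F E c N hcδ hδ hd hT hJ u) (a, b)).2) =
      (archLocalToSymplectic F E c N w hw hc hcδ hδ hT hJ (archAt F E c N J w hw hc (archPart F E c N J u))).1
        (placeVec F (Fin N) v a, placeVec F (Fin N) v b) := by
  have key := placeVec_piArch_resEnd F E c (Fin N) hcδ hδ hd v w hover (re_embedding_delta F E c w hw hc hcδ)
    (im_embedding_delta_ne_zero F E c w hw hc hcδ hδ)
    ((u : GL (Fin N) (AdeleRing (𝓞 E) E)) : Matrix (Fin N) (Fin N) (AdeleRing (𝓞 E) E)) a b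
  have hmat : adeleMatAt E (Fin N) w ((u : GL (Fin N) (AdeleRing (𝓞 E) E)) : Matrix (Fin N) (Fin N) _) =
      (((archAt F E c N J w hw hc (archPart F E c N J u) : archLocal E N J w) : GL (Fin N) ℂ) :
        Matrix (Fin N) (Fin N) ℂ) :=
    Matrix.ext fun i j => rfl
  rw [hmat] at key
  exact key

/-- **(γ) the decl of record.** For `u ∈ G₁(𝔸_F) = U(J_V ⊗ J_W)(𝔸_F)` and
`ι = UnitaryDualPair.toSp = spReindex e ∘ adelicPairToSymplectic`, the `v`-slices of `archAct 𝕋 (ι u)` are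
`Res_{ℂ/ℝ}` of the `e`-relabelled `w`-component `reindex e e (u_w)`, `w ∣ v` complex.
[cite: GelbartRogawski1991, §3.1 p. 454] -/
theorem placeVec_archAct_toSp (N M : ℕ) {m : ℕ} (e : Fin N × Fin M ≃ Fin m) {δ : E} (hcδ : c δ = -δ) (hδ : δ ≠ 0)
    {d : F} (hd : δ * δ = algebraMap F E d) {TV : Matrix (Fin N) (Fin N) F} {TW : Matrix (Fin M) (Fin M) F}
    (hV : TV.IsSymm) (hW : TW.IsSymm) {JV : Matrix (Fin N) (Fin N) E} {JW : Matrix (Fin M) (Fin M) E}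
    (hJV : JV = TV.map (algebraMap F E)) (hJW : JW = TW.map (algebraMap F E))
    (v : {v : InfinitePlace F // v.IsReal}) (w : {w : InfinitePlace E // w.IsComplex})
    (hover : w.1.comap (algebraMap F E) = v.1) (hre : (w.1.embedding δ).re = 0) (him : (w.1.embedding δ).im ≠ 0)
    (u : adelicPair F E c N M JV JW) (a b : Fin m → mixedSpace F) :
    (placeVec F (Fin m) v (archAct (GelbartRogawski1991.UnitaryDualPair.adelicGram F e TV TW)
        (GelbartRogawski1991.UnitaryDualPair.toSp F E c N M e JV JW hcδ hδ hd hV hW hJV hJW u) (a, b)).1,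
      placeVec F (Fin m) v (archAct (GelbartRogawski1991.UnitaryDualPair.adelicGram F e TV TW)
        (GelbartRogawski1991.UnitaryDualPair.toSp F E c N M e JV JW hcδ hδ hd hV hW hJV hJW u) (a, b)).2) =
      (isQuadraticCoordinates_complex (w.1.embedding δ) hre him).resEnd (Fin m)
        (Matrix.reindex e e (adeleMatAt E (Fin N × Fin M) w
          ((u : GL (Fin N × Fin M) (AdeleRing (𝓞 E) E)) : Matrix (Fin N × Fin M) (Fin N × Fin M) _)))
        (placeVec F (Fin m) v a, placeVec F (Fin m) v b) := by
  have key := placeVec_piArch_resEnd F E c (Fin N × Fin M) hcδ hδ hd v w hover hre him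
    ((u : GL (Fin N × Fin M) (AdeleRing (𝓞 E) E)) : Matrix (Fin N × Fin M) (Fin N × Fin M) (AdeleRing (𝓞 E) E))
    (a ∘ e) (b ∘ e)
  rw [IsQuadraticCoordinates.resEnd_reindex_apply]
  have lhs : (placeVec F (Fin m) v (archAct (GelbartRogawski1991.UnitaryDualPair.adelicGram F e TV TW)
        (GelbartRogawski1991.UnitaryDualPair.toSp F E c N M e JV JW hcδ hδ hd hV hW hJV hJW u) (a, b)).1,
      placeVec F (Fin m) v (archAct (GelbartRogawski1991.UnitaryDualPair.adelicGram F e TV TW)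
        (GelbartRogawski1991.UnitaryDualPair.toSp F E c N M e JV JW hcδ hδ hd hV hW hJV hJW u) (a, b)).2) =
      reindexW ℝ e
        (placeVec F (Fin N × Fin M) v (piArch F (Fin N × Fin M)
          ((isQuadraticCoordinates_adele E c hcδ hδ hd).resEnd (Fin N × Fin M)
            ((u : GL (Fin N × Fin M) (AdeleRing (𝓞 E) E)) : Matrix (Fin N × Fin M) (Fin N × Fin M) _)
            (archVec F (Fin N × Fin M) (a ∘ e), archVec F (Fin N × Fin M) (b ∘ e))).1),
        placeVec F (Fin N × Fin M) v (piArch F (Fin N × Fin M)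
          ((isQuadraticCoordinates_adele E c hcδ hδ hd).resEnd (Fin N × Fin M)
            ((u : GL (Fin N × Fin M) (AdeleRing (𝓞 E) E)) : Matrix (Fin N × Fin M) (Fin N × Fin M) _)
            (archVec F (Fin N × Fin M) (a ∘ e), archVec F (Fin N × Fin M) (b ∘ e))).2)) := rfl
  rw [lhs, key]
  rfl

omit [NumberField F] [Algebra.IsQuadraticExtension F E] in
/-- **`(a(u₁) · b(u₂))_w = (u₁)_w ⊗ₖ (u₂)_w`**: the `w`-component of `u₁ ⊗ 1 · 1 ⊗ u₂ ∈ G₁(𝔸_F)` is the Kronecker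
product of the `w`-components (the matrices of `archAt w (archPart uᵢ)`). [folklore] -/
theorem adeleMatAt_adelicInl_mul_adelicInr (N M : ℕ) {JV : Matrix (Fin N) (Fin N) E} {JW : Matrix (Fin M) (Fin M) E}
    (w : {w : InfinitePlace E // w.IsComplex}) (u₁ : adelic F E c N JV) (u₂ : adelic F E c M JW) :
    adeleMatAt E (Fin N × Fin M) w
        (((adelicInl F E c N M JV JW u₁ * adelicInr F E c N M JV JW u₂ : adelicPair F E c N M JV JW) :
          GL (Fin N × Fin M) (AdeleRing (𝓞 E) E)) : Matrix (Fin N × Fin M) (Fin N × Fin M) _) =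
      adeleMatAt E (Fin N) w ((u₁ : GL (Fin N) (AdeleRing (𝓞 E) E)) : Matrix (Fin N) (Fin N) _) ⊗ₖ
        adeleMatAt E (Fin M) w ((u₂ : GL (Fin M) (AdeleRing (𝓞 E) E)) : Matrix (Fin M) (Fin M) _) := by
  rw [Subgroup.coe_mul, Units.val_mul, coe_adelicInl, coe_adelicInr, ← Matrix.mul_kronecker_mul, Matrix.mul_one,
    Matrix.one_mul, adeleMatAt, adeleMatAt, adeleMatAt, kronecker_map_map]

/-- **(γ′) the decl of record on the product `U(J_V)(𝔸_F) × U(J_W)(𝔸_F)`** (pair-factored form of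
`placeVec_archAct_toSp`, for every pair — no torus hypothesis): for `u = a(u₁) · b(u₂)` the `v`-slices of
`archAct 𝕋 (toSp u)` are `Res_{ℂ/ℝ}` of `reindex e e ((u₁)_w ⊗ₖ (u₂)_w)` with `(uᵢ)_w = archAt w (archPart uᵢ)` — so
a consumer may take `(u₁, u₂) ↦ (archAt w(v) (archPart u₁), archAt w(v) (archPart u₂))_v`, a continuous homomorphism
into `∏_v U(σ_w J_V)(ℂ) × U(σ_w J_W)(ℂ)`, as the archimedean datum. [cite: GelbartRogawski1991, §3.1 p. 454] -/
theorem placeVec_archAct_toSp_inl_mul_inr (N M : ℕ) {m : ℕ} (e : Fin N × Fin M ≃ Fin m) {δ : E} (hcδ : c δ = -δ)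
    (hδ : δ ≠ 0) (hc : c ≠ 1) {d : F} (hd : δ * δ = algebraMap F E d) {TV : Matrix (Fin N) (Fin N) F}
    {TW : Matrix (Fin M) (Fin M) F} (hV : TV.IsSymm) (hW : TW.IsSymm) {JV : Matrix (Fin N) (Fin N) E}
    {JW : Matrix (Fin M) (Fin M) E} (hJV : JV = TV.map (algebraMap F E)) (hJW : JW = TW.map (algebraMap F E))
    (v : {v : InfinitePlace F // v.IsReal}) (w : {w : InfinitePlace E // w.IsComplex}) (hw : c • w.1 = w.1)
    (hover : w.1.comap (algebraMap F E) = v.1) (hre : (w.1.embedding δ).re = 0) (him : (w.1.embedding δ).im ≠ 0)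
    (u₁ : adelic F E c N JV) (u₂ : adelic F E c M JW) (a b : Fin m → mixedSpace F) :
    (placeVec F (Fin m) v (archAct (GelbartRogawski1991.UnitaryDualPair.adelicGram F e TV TW)
        (GelbartRogawski1991.UnitaryDualPair.toSp F E c N M e JV JW hcδ hδ hd hV hW hJV hJW
          (adelicInl F E c N M JV JW u₁ * adelicInr F E c N M JV JW u₂)) (a, b)).1,
      placeVec F (Fin m) v (archAct (GelbartRogawski1991.UnitaryDualPair.adelicGram F e TV TW)
        (GelbartRogawski1991.UnitaryDualPair.toSp F E c N M e JV JW hcδ hδ hd hV hW hJV hJW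
          (adelicInl F E c N M JV JW u₁ * adelicInr F E c N M JV JW u₂)) (a, b)).2) =
      (isQuadraticCoordinates_complex (w.1.embedding δ) hre him).resEnd (Fin m)
        (Matrix.reindex e e
          ((((archAt F E c N JV w hw hc (archPart F E c N JV u₁) : archLocal E N JV w) : GL (Fin N) ℂ) :
              Matrix (Fin N) (Fin N) ℂ) ⊗ₖ
            (((archAt F E c M JW w hw hc (archPart F E c M JW u₂) : archLocal E M JW w) : GL (Fin M) ℂ) :
              Matrix (Fin M) (Fin M) ℂ)))
        (placeVec F (Fin m) v a, placeVec F (Fin m) v b) := by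
  rw [placeVec_archAct_toSp F E c N M e hcδ hδ hd hV hW hJV hJW v w hover hre him _ a b,
    adeleMatAt_adelicInl_mul_adelicInr]
  rfl

/-- **(γ-torus) the literal hypothesis `hg` of `archFolland_archAct_torus` (STEP 2, `ι = Fin m`,
`Ψ v = complexCoords (σ_{w(v)} δ)`) for `g = toSp u`**, when every archimedean component `u_{w(v)}` is the
`e`-relabelled compact torus `torusGL θ_{·,v}`. [cite: Folland1989, Ch. 4 §1, Prop. (4.6) p. 151] -/
theorem archAct_toSp_torus (N M : ℕ) {m : ℕ} (e : Fin N × Fin M ≃ Fin m) {δ : E} (hcδ : c δ = -δ)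
    (hδ : δ ≠ 0) {d : F} (hd : δ * δ = algebraMap F E d) {TV : Matrix (Fin N) (Fin N) F}
    {TW : Matrix (Fin M) (Fin M) F} (hV : TV.IsSymm) (hW : TW.IsSymm) {JV : Matrix (Fin N) (Fin N) E}
    {JW : Matrix (Fin M) (Fin M) E} (hJV : JV = TV.map (algebraMap F E)) (hJW : JW = TW.map (algebraMap F E))
    (wOf : {v : InfinitePlace F // v.IsReal} → {w : InfinitePlace E // w.IsComplex})
    (hover : ∀ v, (wOf v).1.comap (algebraMap F E) = v.1) (hre : ∀ v, ((wOf v).1.embedding δ).re = 0)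
    (him : ∀ v, ((wOf v).1.embedding δ).im ≠ 0) (u : adelicPair F E c N M JV JW)
    (θ : Fin m × {v : InfinitePlace F // v.IsReal} → ℝ)
    (hu : ∀ v, adeleMatAt E (Fin N × Fin M) (wOf v) ((u : GL (Fin N × Fin M) (AdeleRing (𝓞 E) E)) :
        Matrix (Fin N × Fin M) (Fin N × Fin M) _) =
      Matrix.reindex e.symm e.symm ((torusGL fun k => θ (k, v) : GL (Fin m) ℂ) : Matrix (Fin m) (Fin m) ℂ))
    (a b : Fin m → mixedSpace F) (v : {v : InfinitePlace F // v.IsReal}) :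
    (placeVec F (Fin m) v (archAct (GelbartRogawski1991.UnitaryDualPair.adelicGram F e TV TW)
        (GelbartRogawski1991.UnitaryDualPair.toSp F E c N M e JV JW hcδ hδ hd hV hW hJV hJW u) (a, b)).1,
      placeVec F (Fin m) v (archAct (GelbartRogawski1991.UnitaryDualPair.adelicGram F e TV TW)
        (GelbartRogawski1991.UnitaryDualPair.toSp F E c N M e JV JW hcδ hδ hd hV hW hJV hJW u) (a, b)).2) =
      (isQuadraticCoordinates_complex ((wOf v).1.embedding δ) (hre v) (him v)).resAut (Fin m)
        (torusGL fun k => θ (k, v)) (placeVec F (Fin m) v a, placeVec F (Fin m) v b) := by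
  rw [placeVec_archAct_toSp F E c N M e hcδ hδ hd hV hW hJV hJW v (wOf v) (hover v) (hre v) (him v) u a b, hu v,
    IsQuadraticCoordinates.resAut_apply]
  congr 1
  simp only [Matrix.reindex_apply, Matrix.submatrix_submatrix, Equiv.symm_symm, Equiv.self_comp_symm,
    Matrix.submatrix_id_id]

end Unitary

end Literature.NumberTheory.Weil1964
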